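import Summits.HodgeConjecture.HodgeConjecture.Theorems.Ring2HypothesesWeilComponentsLadder
import Summits.HodgeConjecture.HodgeConjecture.Theorems.PadicSemiregularLiftHodgeAbelianVarietiesStubDescendPrym
import Literature.AlgebraicGeometry.HodgeTheory.WeilClassesFourfoldsFromSixfoldsHolds
import Literature.AlgebraicGeometry.HodgeTheory.WeilClassesFourfoldsDiscOneSchoen
import Literature.AlgebraicGeometry.HodgeTheory.LefschetzOneOneHolds
import Literature.AlgebraicGeometry.HodgeTheory.HodgeIndexPrimitiveAlgebraicHolds
import HarnessLib

/-!
# Ring 2 — habitat seat A, gen 7: the fourfold components `(ℚ(√-d), 4, δ)` for `d ∈ {1, 3}` and EVERY `δ` from REFEREED facts, and the habitat-table ↔ kernel crosswalk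

HONEST FRAMING: research route conditional on HC_CM; not a corollary; Q11.4-sentence-2 already refuted in dim ≥ 3.

Cell `pub-hodge-ring2`, seat `pub-hodge-ring2-habitat1` (implementation A, period-domain side), gen 7. `HC_CM` is
ALWAYS the binder `(hCM : Theses.RankFourFaces.CMAbelianHodge)` (stmt-HodgeConjecture-3052); it does not occur in this
file at all. Nothing here proves a case of the Hodge conjecture outright: every theorem is an implication whose
hypotheses are NAMED refereed Literature facts (`Schoen1998_weilClasses_algebraic_hyperbolicSixfold_three`,
`Koike2004_weilClasses_algebraic_hyperbolicSixfold_one`, `Schoen1988_weilClasses_algebraic_hyperbolicFourfold_three_or_one`,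
and for comparison the unrefereed `Markman2025_weilClasses_algebraic_hyperbolicSixfold`) and whose conclusions are the
kernel's discriminant-indexed class targets `Ring2.Hypotheses.WeilClassesComponent n d δ` of part VII-A
(`Ring2HypothesesWeilComponents`, seat typer2 gen 5). Sorry-free; axioms `propext`, `Classical.choice`, `Quot.sound`.

## Why this file exists (the crosswalk discrepancy)

The habitat table `HABITATS.md` Table H (seat A, certified against seat B, gens 2–4) indexes the Weil-type components
of `K = ℚ(√-d)` by `(d, 2n, a)`, `det H = (-1)ⁿ·a`, and marks as REFEREED-KNOWN, among the fourfold rows `2n = 4`,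
EVERY discriminant class of `K = ℚ(√-3)` (C. Schoen, Compositio 114 (1998), Theorem p. 329 and §10: "arbitrary
discriminant", by descending from split sixfolds through products with a Weil-type surface) and of `K = ℚ(i)`
(K. Koike, 2004, Remark 2.1: "By the Proposition 10 in [Sc2] … the Hodge conjecture holds for all abelian 4-folds of
Weil type for `ℚ(√-1)`", from his split `ℚ(i)` sixfolds). The kernel's δ-table (part VII-B, rows W5) had, from refereed
sources, only the SPLIT fourfold cell `(2, d, +1)` (Markman, JEMS 2023, granted Landherr) and the split sixfold cells
`(3, 3, -1)`, `(3, 1, -1)`; the non-split fourfold cells of `d ∈ {1, 3}` were reachable only through the unrefereed F1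
(`weilClassesComponent_two_of_markmanFourfolds`). This file closes exactly that gap, BY NAME, with the descent already
PROVED in the tree:

* `weilAlgebraicAll_two_of_floorSlice` — for ONE `d ≥ 1`: the `d`-slice of the split-sixfold floor fact (F2 shape at
  `d`) gives the Weil classes of EVERY Weil-type fourfold `(A, φ)`, `φ ≫ φ = -d` (`EStepSecantInduction.WeilAlgebraicAll
  2 d`), through the proved `stub_descend 2 d` (partner CM surface of opposite discriminant + Schoen's transfer, both
  theorems of the tree: `exists_weilTypeSurface_prod_isHyperbolicWeilType_all_holds`,
  `Schoen1998_weilClasses_algebraic_of_prod_surface_all_holds`). The all-`d` version is the tree's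
  `WeilTypeLadder.floorFourfolds_of_floorSixfolds`; the point here is the slicing, because the refereed inputs exist
  only at `d = 3` and `d = 1`.
* `weilClassesComponent_two_three_of_schoen1998` — **cell `(2, 3, δ)` for EVERY `δ ∈ ℚˣ/Nm ℚ(√-3)ˣ`** from
  `Schoen1998_weilClasses_algebraic_hyperbolicSixfold_three` ALONE (no Landherr, no `HC_CM`, no preprint).
* `weilClassesComponent_two_one_of_koike2004` — **cell `(2, 1, δ)` for EVERY `δ ∈ ℚˣ/Nm ℚ(i)ˣ`** from
  `Koike2004_weilClasses_algebraic_hyperbolicSixfold_one` ALONE.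
* `weilClassesComponent_split_two_of_schoen1988` — the split cell `(2, d, +1)`, `d ∈ {1, 3}`, from the 1988 source
  (`Schoen1988_weilClasses_algebraic_hyperbolicFourfold_three_or_one`, van Geemen Thm. 4.15), granted Landherr — a second
  refereed closing of a cell part VII-B closes from Markman 2023.
* bookkeeping: `schoen1998_prodSurface_transfer_sixfold_fourfold` discharges the `6 → 4` named transfer fact
  `Schoen1998_weilClasses_algebraic_of_prod_surface` of `Literature/…/WeilClassesFourfoldsFromSixfolds` (the tree's
  all-`n` transfer `…_all_of_algebraic_of_hodgeIndex` at `n = 2`, its two surface inputs being the theorems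
  `lefschetzOneOne_rational_holds` and `hodgeIndex_surface_holds`), so that the Literature assembly
  `Markman2025_weilClasses_algebraic_abelianFourfold_holds_of` has ONE open input, F2 (the composite F2 ⟹ F1 is
  already the tree's `WeilTypeLadder.floorFourfolds_of_floorSixfolds` and is not restated).

## Crosswalk rows (HABITATS.md §habitat1 (gen 7), `code/habitat_A/crosswalk/`)

Table-H row `(d, 2n, a)` ↦ kernel target `WeilClassesComponent n d δ`, `δ = [(-1)ⁿ·a] ∈ weilNormResidueGroup d`
(split row `a ∈ Nm K^×` ↦ `δ = splitDiscriminantClass n d`). Closing lemmas by cell after this file: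
`(2, d, δ)` any `d`: F1 or F2 (unrefereed) — `weilClassesComponent_two_of_markmanFourfolds`,
`weilClassesComponent_two_of_markmanSixfolds`; `(2, d, +1)`: Markman 2023 + Landherr (refereed); `(2, 3, δ)`, `(2, 1, δ)`
EVERY `δ`: Schoen 1998 resp. Koike 2004 (refereed, THIS FILE); `(3, d, -1)`: F2 + Landherr; `(3, 3, -1)`, `(3, 1, -1)`:
Schoen 1998 / Koike 2004 + Landherr (refereed); every other cell (`n = 3` non-split, `n ≥ 4`): OPEN, content
`WeilVariationalHodgeComponent n d δ` (part VII-A W1). PRINT MATCH of the two new rows: [Schoen 1998, Theorem p. 329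
(fourfolds, `K = ℚ(√-3)`, arbitrary discriminant) and §10 Proposition]; [Koike 2004, Remark 2.1].

## References

* [Schoen1998HodgeWeilAddendum] C. Schoen, Addendum to: Hodge classes on self-products of a variety with an
  automorphism, Compositio Math. 114 (1998) 329–336: Theorem (p. 329), §10 Proposition (pp. 332–333), §§11–13.
* [Schoen1988HodgeWeil] C. Schoen, Hodge classes on self-products of a variety with an automorphism, Compositio
  Math. 65 (1988) 3–32: Thm. 3.2, §3.
* [Koike2004WeilHodge] K. Koike, Algebraicity of some Weil Hodge classes, Canad. Math. Bull. 47 (2004): Thm. 2.1,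
  Cor. 2.1, Remark 2.1.
* [vanGeemen1994HodgeAV] B. van Geemen, LNM 1594 (1994): Thm. 4.15, Lemma 5.2, 5.3–5.5, (5.4.1), Thm. 6.12.
* [Markman2023GeneralizedKummers] E. Markman, JEMS 25 (2023), Thm. 1.5 (= Thm. 13.4), p. 236 (printed numbering; it is
  Thm. 1.3 of the pre-v4 arXiv text 1805.11574 — locator erratum A-lit-79-1 / E-T144-1, docstring-only).
  [Markman2025SecantWeil] arXiv:2502.03415
  (UNREFEREED), Thm. 1.5.1, Cor. 1.6.1. [Markman2025SurveySecant] arXiv:2509.23403 §11.5 Step 2.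
-/

set_option linter.dupNamespace false

noncomputable section

open CategoryTheory
open Literature.AlgebraicGeometry Literature.AlgebraicGeometry.Motives
open Literature.AlgebraicGeometry.HodgeTheory
open Literature.AlgebraicTopology.SingularHomology
open Literature.AlgebraicGeometry.VanGeemen1994
open Summit.HodgeConjecture.HodgeConjecture.Ring2.Hypotheses
open Summit.HodgeConjecture.HodgeConjecture.Cruxes.HodgeAbelianVarieties.EStepSecantInduction
open Summit.HodgeConjecture.HodgeConjecture.Cruxes.HodgeAbelianVarieties.PrymCanonicalZ3SplitSeeds.Stubs.Descend
  (stub_descend)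

namespace Summit.HodgeConjecture.HodgeConjecture.Ring2.Habitat

/-! ### §1 Bookkeeping: the `6 → 4` transfer fact is a theorem -/

/-- **Schoen's transfer `6 → 4` (C. Schoen, Compositio 114 (1998) §10 Proposition), the named fact
`Schoen1998_weilClasses_algebraic_of_prod_surface` of `Literature/…/WeilClassesFourfoldsFromSixfolds`, DISCHARGED.**
Its surface hypothesis (a rational `(1,1)` Weil class `u₊ + u₋` with both eigencomponents non-zero) is weaker than the
one of the all-`n` transfer `…_all` (which also asks for Schoen's descent partner `t`); the gap is exactly Lefschetz
`(1,1)` for `u₊ + u₋` and the Hodge index theorem on the surface, both THEOREMS of the tree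
(`lefschetzOneOne_rational_holds`, `hodgeIndex_surface_holds`), fed into the tree's
`Schoen1998_weilClasses_algebraic_of_prod_surface_all_of_algebraic_of_hodgeIndex` at `n = 2` (`u₊ + u₋ ≠ 0` because
`E₊ ⊓ E₋ = 0`). A Literature seat may re-export this as the canonical `…_holds`.
[cite: Schoen1998HodgeWeilAddendum, §10 (Proposition and proof, pp. 332–333)] [cite: VoisinHodgeI2002, Thm. 11.30]
[cite: Hartshorne1977, App. A Thm. 5.2] -/
theorem schoen1998_prodSurface_transfer_sixfold_fourfold : Schoen1998_weilClasses_algebraic_of_prod_surface := by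
  intro d hd A₁ φ₁ A₂ φ₂ _ hX₁ _ _ hX₂ _ hwt h6 c hc hcH hcW
  obtain ⟨up, um, hup, hum, hr₂, hw₂, hup0, -⟩ := hwt
  -- `u = u₊ + u₋ ≠ 0` since `E₊ ⊓ E₋ = 0`
  have h0 : up + um ≠ 0 := by
    intro h
    have hup' : up ∈ weilClassesMinus A₂ φ₂ 1 d := by
      rw [eq_neg_of_add_eq_zero_left h]
      exact Submodule.neg_mem _ hum
    exact hup0 (Submodule.disjoint_def.mp
      (disjoint_weilClassesPlus_weilClassesMinus A₂ φ₂ Nat.one_pos hd) up hup hup')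
  -- Lefschetz `(1,1)` on the surface: the rational `(1,1)` class `u` is algebraic
  have hN : up + um ∈ algebraicClasses A₂.X 1 := lefschetzOneOne_rational_holds hX₂ (up + um) hr₂ hw₂
  exact Schoen1998_weilClasses_algebraic_of_prod_surface_all_of_algebraic_of_hodgeIndex (n := 2) two_pos hd φ₁ φ₂
    hX₁ hX₂ hup hum hr₂ hw₂ hN h0 hodgeIndex_surface_holds h6 hc hcH hcW

/-! ### §2 Slicing the descent: one `d` at a time -/

/-- **The `d`-slice of the split-sixfold floor, in the e-step line's hyperplane convention.** For one `d`, the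
`d`-slice of the F2 shape (split sixfolds `(A, φ)`, `φ ≫ φ = -d`, hyperbolic for a `K`-symmetrised hyperplane class)
gives `Stubs.WeilAlgebraicSplitHyperplane 3 d` (binder bookkeeping; smooth-projectivity of an abelian sixfold is
`isSmoothProjective_of_dim_eq'`). [cite: Markman2025SecantWeil, Thm. 1.5.1 (shape only)] [cite: MumfordAV1970, §4 (ii)] -/
theorem weilAlgebraicSplitHyperplane_three_of_floorSlice {d : ℕ}
    (hF : ∀ (A : AbelianVariety ℂ) (φ : A ⟶ A), A.dim = 2 * 3 → IsSmoothProjective (2 * 3) A.X →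
      φ ≫ φ = -(d • 𝟙 A) → ∀ (e : ProjectiveEmbedding A.X) (a : complexBetti (projectiveSpace e.n ℂ) 2),
        IsRationalClass a → a ≠ 0 →
          IsHyperbolicWeilType A φ 3
            ((d : ℂ) • complexBetti.map e.ι 2 a + complexBetti.map φ.hom.hom.hom 2 (complexBetti.map e.ι 2 a)) →
          ∀ c : complexBetti A.X (2 * 3), IsRationalClass c → IsOfHodgeType (2 * 3) A.X (2 * 3) 3 3 c →
            c ∈ weilClassesOf A φ 3 d → c ∈ algebraicClasses A.X 3) :
    Stubs.WeilAlgebraicSplitHyperplane 3 d := by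
  intro B ψ e a hB hψ ha ha0 hhyp c hcW hc hH
  exact hF B ψ hB (isSmoothProjective_of_dim_eq' hB) hψ e a ha ha0 hhyp c hc hH hcW

/-- **DESCENT, sliced: for ONE `d ≥ 1`, split sixfolds of `K = ℚ(√-d)` give EVERY Weil-type fourfold of `K`, every
discriminant** (`WeilAlgebraicAll 2 d`) — the tree's PROVED `stub_descend 2 d` (partner CM surface of opposite
discriminant, `exists_weilTypeSurface_prod_isHyperbolicWeilType_all_holds`; Schoen's transfer,
`Schoen1998_weilClasses_algebraic_of_prod_surface_all_holds`). This is Schoen 1998 §10 / Koike 2004 Rem. 2.1 /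
Markman Cor. 1.6.1 sentence 1, kernel-checked, with no named-fact hypothesis besides the slice itself.
[cite: Schoen1998HodgeWeilAddendum, §10 (Proposition, pp. 332–333)] [cite: Koike2004WeilHodge, Remark 2.1]
[cite: vanGeemen1994HodgeAV, Lemma 5.2, 5.5] -/
theorem weilAlgebraicAll_two_of_floorSlice {d : ℕ} (hd : 0 < d)
    (hF : ∀ (A : AbelianVariety ℂ) (φ : A ⟶ A), A.dim = 2 * 3 → IsSmoothProjective (2 * 3) A.X →
      φ ≫ φ = -(d • 𝟙 A) → ∀ (e : ProjectiveEmbedding A.X) (a : complexBetti (projectiveSpace e.n ℂ) 2),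
        IsRationalClass a → a ≠ 0 →
          IsHyperbolicWeilType A φ 3
            ((d : ℂ) • complexBetti.map e.ι 2 a + complexBetti.map φ.hom.hom.hom 2 (complexBetti.map e.ι 2 a)) →
          ∀ c : complexBetti A.X (2 * 3), IsRationalClass c → IsOfHodgeType (2 * 3) A.X (2 * 3) 3 3 c →
            c ∈ weilClassesOf A φ 3 d → c ∈ algebraicClasses A.X 3) :
    WeilAlgebraicAll 2 d :=
  stub_descend 2 d le_rfl hd (weilAlgebraicSplitHyperplane_three_of_floorSlice hF)

/-- **`WeilAlgebraicAll 2 d` gives every fourfold component `(2, d, δ)`** (drop the polarizing pair and the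
discriminant hypothesis of the class target). [cite: vanGeemen1994HodgeAV, Lemma 5.2 (3)] -/
theorem weilClassesComponent_two_of_weilAlgebraicAll {d : ℕ} (h : WeilAlgebraicAll 2 d)
    (δ : weilNormResidueGroup d) : WeilClassesComponent 2 d δ :=
  fun A φ hA _ hφ _ _ _ _ _ c hc hnn hw ↦ h A φ hA hφ c hw hc hnn

/-- **Cell `(2, d, δ)`, every `d ≥ 1`, every `δ`, from F2 alone** (Markman's split-SIXFOLD fact, preprint,
UNREFEREED; no Landherr): the kernel's row W5 `(2, d, δ)` with its input moved one rung down (F1 ⟸ F2).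
[cite: Markman2025SecantWeil, Thm. 1.5.1 and Cor. 1.6.1 (preprint, unrefereed)] -/
theorem weilClassesComponent_two_of_markmanSixfolds (hM : Markman2025_weilClasses_algebraic_hyperbolicSixfold)
    {d : ℕ} (hd : 0 < d) (δ : weilNormResidueGroup d) : WeilClassesComponent 2 d δ :=
  weilClassesComponent_two_of_weilAlgebraicAll (weilAlgebraicAll_two_of_floorSlice hd (hM d hd)) δ

/-! ### §3 The refereed cells: `K = ℚ(√-3)` (Schoen 1998) and `K = ℚ(i)` (Koike 2004), dimension four, EVERY `δ` -/

/-- **Every Weil-type FOURFOLD of `K = ℚ(√-d)`, `d ∈ {1, 3}`, every discriminant, from REFEREED facts**: Koike 2004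
(split `ℚ(i)` sixfolds) resp. Schoen 1998 (split `ℚ(√-3)` sixfolds), descended. [cite: Schoen1998HodgeWeilAddendum, Theorem (p. 329) and §10]
[cite: Koike2004WeilHodge, Cor. 2.1 and Remark 2.1] -/
theorem weilAlgebraicAll_two_of_refereed_one_or_three (hK : Koike2004_weilClasses_algebraic_hyperbolicSixfold_one)
    (hS : Schoen1998_weilClasses_algebraic_hyperbolicSixfold_three) {d : ℕ} (hd : d = 1 ∨ d = 3) :
    WeilAlgebraicAll 2 d := by
  rcases hd with rfl | rfl
  · exact weilAlgebraicAll_two_of_floorSlice one_pos hK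
  · exact weilAlgebraicAll_two_of_floorSlice (by norm_num) hS

/-- **Cell `(2, 3, δ)` for EVERY `δ ∈ ℚˣ/Nm ℚ(√-3)ˣ` — `K = ℚ(√-3)`, abelian fourfolds of Weil type of ARBITRARY
discriminant — from the REFEREED `Schoen1998_weilClasses_algebraic_hyperbolicSixfold_three` ALONE** (Schoen,
Compositio 114 (1998), Theorem p. 329: "the Hodge conjecture holds for four-dimensional abelian varieties of Weil
type with `K = ℚ(√-3)` and arbitrary discriminant"; proof §10 + §§11–13). The habitat table's refereed fourfold rows of
`ℚ(√-3)`, now kernel rows. [cite: Schoen1998HodgeWeilAddendum, Theorem (p. 329), §10 (Proposition) and §§11–13]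
[cite: vanGeemen1994HodgeAV, Lemma 5.2, 5.5 and Thm. 6.12] -/
theorem weilClassesComponent_two_three_of_schoen1998 (hS : Schoen1998_weilClasses_algebraic_hyperbolicSixfold_three)
    (δ : weilNormResidueGroup 3) : WeilClassesComponent 2 3 δ :=
  weilClassesComponent_two_of_weilAlgebraicAll (weilAlgebraicAll_two_of_floorSlice (by norm_num) hS) δ

/-- **Cell `(2, 1, δ)` for EVERY `δ ∈ ℚˣ/Nm ℚ(i)ˣ` — `K = ℚ(i)`, abelian fourfolds of Weil type of ARBITRARY
discriminant — from the REFEREED `Koike2004_weilClasses_algebraic_hyperbolicSixfold_one` ALONE** (Koike 2004,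
Remark 2.1: "By the Proposition 10 in [Sc2], … the Hodge conjecture holds for all abelian 4-folds of Weil type for
`ℚ(√-1)`"). The habitat table's refereed fourfold rows of `ℚ(i)`, now kernel rows.
[cite: Koike2004WeilHodge, Thm. 2.1, Cor. 2.1 and Remark 2.1] [cite: Schoen1998HodgeWeilAddendum, §10 (Proposition)]
[cite: vanGeemen1994HodgeAV, Lemma 5.2, 5.5 and Thm. 6.12] -/
theorem weilClassesComponent_two_one_of_koike2004 (hK : Koike2004_weilClasses_algebraic_hyperbolicSixfold_one)
    (δ : weilNormResidueGroup 1) : WeilClassesComponent 2 1 δ :=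
  weilClassesComponent_two_of_weilAlgebraicAll (weilAlgebraicAll_two_of_floorSlice one_pos hK) δ

/-- **The two refereed fourfold rows together**: `d ∈ {1, 3}`, every `δ`.
[cite: Schoen1998HodgeWeilAddendum, Theorem (p. 329)] [cite: Koike2004WeilHodge, Remark 2.1] -/
theorem weilClassesComponent_two_of_refereed_one_or_three (hK : Koike2004_weilClasses_algebraic_hyperbolicSixfold_one)
    (hS : Schoen1998_weilClasses_algebraic_hyperbolicSixfold_three) {d : ℕ} (hd : d = 1 ∨ d = 3)
    (δ : weilNormResidueGroup d) : WeilClassesComponent 2 d δ :=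
  weilClassesComponent_two_of_weilAlgebraicAll (weilAlgebraicAll_two_of_refereed_one_or_three hK hS hd) δ

/-- **F1's `d`-slice in its literal binder shape, `d ∈ {1, 3}`, from refereed facts** (for consumers typed against
`Markman2025_weilClasses_algebraic_abelianFourfold`'s shape, e.g. the Moonen–Zarhin reduction in dimension `≤ 5`,
which however needs every `d`). [cite: Schoen1998HodgeWeilAddendum, Theorem (p. 329)] [cite: Koike2004WeilHodge, Remark 2.1] -/
theorem markmanFourfold_slice_of_refereed_one_or_three (hK : Koike2004_weilClasses_algebraic_hyperbolicSixfold_one)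
    (hS : Schoen1998_weilClasses_algebraic_hyperbolicSixfold_three) {d : ℕ} (hd : d = 1 ∨ d = 3) :
    ∀ (A : AbelianVariety ℂ) (φ : A ⟶ A), A.dim = 2 * 2 → IsSmoothProjective (2 * 2) A.X → φ ≫ φ = -(d • 𝟙 A) →
      ∀ c : complexBetti A.X (2 * 2), IsRationalClass c → IsOfHodgeType (2 * 2) A.X (2 * 2) 2 2 c →
        c ∈ weilClassesOf A φ 2 d → c ∈ algebraicClasses A.X 2 :=
  fun A φ hA _ hφ c hc hnn hw ↦ weilAlgebraicAll_two_of_refereed_one_or_three hK hS hd A φ hA hφ c hw hc hnn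

/-! ### §4 The split fourfold cell `(2, d, +1)`, `d ∈ {1, 3}`, from the 1988 source -/

/-- **Cell `(2, d, +1)` for `d ∈ {1, 3}` from Schoen 1988 / van Geemen Thm. 4.15
(`Schoen1988_weilClasses_algebraic_hyperbolicFourfold_three_or_one`, refereed), granted Landherr's criterion** — a
second refereed closing of the split fourfold cells of `ℚ(i)`, `ℚ(√-3)` (part VII-B closes `(2, d, +1)` for every `d`
from Markman 2023). [cite: Schoen1988HodgeWeil, Thm. 3.2 and §3] [cite: vanGeemen1994HodgeAV, Thm. 4.15 and (5.4.1)] -/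
theorem weilClassesComponent_split_two_of_schoen1988 (hL : LandherrSplitCriterion)
    (hF : Schoen1988_weilClasses_algebraic_hyperbolicFourfold_three_or_one) {d : ℕ} (hd : d = 1 ∨ d = 3) :
    WeilClassesComponent 2 d (splitDiscriminantClass 2 d) := by
  have hd0 : 0 < d := by rcases hd with rfl | rfl <;> norm_num
  intro A φ hA hX hφ e a haQ ha0 hδ c hcQ hcH hw
  by_cases hc0 : c = 0
  · rw [hc0]; exact Submodule.zero_mem _
  exact hF d hd A φ hA hX hφ e a haQ ha0
    ((hL 2 d (by norm_num) hd0 A φ hA hφ e a haQ ha0 ⟨c, hw, hcQ, hcH, hc0⟩).2 hδ) c hcQ hcH hw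

/-! ### §5 On-path (sanity): the new rows are cases of the summit -/

/-- The targets closed in §3 are cases of the Hodge conjecture (part VII-B `weilClassesComponent_of_hodgeConjecture`,
recorded at the two refereed cells for the crosswalk's on-path column). [cite: Deligne2000, §1] -/
theorem weilClassesComponent_two_of_refereed_onPath (h : _root_.HodgeConjecture) {d : ℕ} (_hd : d = 1 ∨ d = 3)
    (δ : weilNormResidueGroup d) : WeilClassesComponent 2 d δ :=
  weilClassesComponent_of_hodgeConjecture h 2 d δ

end Summit.HodgeConjecture.HodgeConjecture.Ring2.Habitat

end
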